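import Mathlib
import HarnessLib
import Summits.KontsevichZagierPeriods.KontsevichZagierPeriods.Theses.LinRedNormalForm
import Summits.KontsevichZagierPeriods.KontsevichZagierPeriods.Theorems.LinRedNormalFormDihedralNormalFormStubAtomReduction
import Summits.KontsevichZagierPeriods.KontsevichZagierPeriods.Theorems.LinRedNormalFormDihedralNormalFormStubUnnestingThree
import Summits.KontsevichZagierPeriods.KontsevichZagierPeriods.Theorems.LinRedNormalFormDihedralNormalFormDimLeThree

/-!
# `DihedralNormalForm` from unnesting in dimension `≥ 4` (line `torus-descent-sum-shadow`, closing)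

The conditional closing theorem `dihedralNormalForm_of_unnestingHigh` of the line
`torus-descent-sum-shadow` for the crux `DihedralNormalForm` (stmt-KontsevichZagierPeriods-3912,
route `LinRedNormalForm`): the crux is REDUCED to the residual statement `stub_unnestingHigh` —
UNNESTING IN DIMENSION `k ≥ 4`: a non-nested convergent cubical atom
`[□ᵏ, q · xᵃ · ∏_{i ≤ j} (1 - x_{[i,j]})^{e i j}]` (two active chords of length `≥ 2` that are
`⊆`-incomparable) is congruent modulo `KZ.relations` to a `ℤ`-combination of nested atoms,
SD1-directed atoms, word atoms of dimension `k` and atoms of lower dimension. Taking that statement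
(verbatim) as a hypothesis, EVERY absolutely convergent genus-zero representation
`[Δ_k, P(t) / (∏ tᵢ^{bᵢ} ∏ (1 - tᵢ)^{cᵢ} ∏_{i<j} (tᵢ - tⱼ)^{aᵢⱼ})]` is congruent modulo
`KZ.relations` to a `ℤ`-combination of MZV word representations `[Δ_w, q · ∏ ω_{εᵢ}(tᵢ)]`, i.e.
`LinRedNormalForm.DihedralNormalForm` holds BY NAME.

The proof is the full composition of the line's landed stubs, through the nodes already landed with
the dimension-`≤ 3` corollary (`…DimLeThree`, namespace `DimLeThree`: `closure_transfer`,
`red_union`, `red_of_sub_mem`, `wAtom_red`, `sd1Atom_red`, `atomLT_red`, `nAtom_red`):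
* ENTRANCE `stub_atomReduction`: the input is congruent to a combination of convergent cubical
  atoms;
* strong induction on the dimension (`OfUnnestingHigh.atom_red`, the only new node): a NON-NESTED
  atom is unnested — by the landed `stub_unnesting_le_three` in dimension `≤ 3`, by the hypothesis
  in dimension `≥ 4` — into nested ∪ SD1-directed ∪ word ∪ lower-dimensional atoms; a NESTED atom
  goes to word ∪ SD1-directed ∪ lower-dimensional atoms by THEOREM N `stub_nestedReduction`
  (`DimLeThree.nAtom_red`); an SD1-DIRECTED atom descends one dimension by `stub_torusDescent` and
  is re-cubed by `stub_rebaseOne` (`DimLeThree.sd1Atom_red`, induction hypothesis); a WORD atom is a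
  word representation read in the cubical chart, `stub_wordAtomChart` (`DimLeThree.wAtom_red`, EXIT);
* the generator-wise congruences extend additively to the generated subgroups
  (`DimLeThree.closure_transfer`).
No definitions are introduced: the generator families, the reduction relation and the hypothesis
are parse-time notations (`WORDS`, `ATOMS⟪k⟫`, …, `RED⟪S, T⟫`, `UNNESTING_HIGH`), re-declared here
byte-for-byte from `…DimLeThree` (notations are file-local).

References: M. Kontsevich, D. Zagier, *Periods* (2001), §1.2; F. Brown, *Multiple zeta values and
periods of moduli spaces* `M_{0,n}`, Ann. Sci. ÉNS 42 (2009), Thm 1.1 (the value-level shadow).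
-/

noncomputable section

open MeasureTheory Set

namespace Summit.KontsevichZagierPeriods.DihedralNormalForm.TorusDescent

open Literature.NumberTheory.Transcendental

namespace OfUnnestingHigh

open DimLeThree

/-! ### Notation (parse-time abbreviations, as in `…DimLeThree`; no definitions are introduced) -/

set_option quotPrecheck false

/-- The crux's target generators: MZV word representations `[Δ_w, q · ∏ ω_{εᵢ}(tᵢ)]`. -/
local notation "WORDS" =>
  ({x : Literature.NumberTheory.Transcendental.KZ.FormalRep | ∃ (w : ℕ) (ε : Fin w → Bool) (q : ℚ) (s : Literature.NumberTheory.Transcendental.KZ.IntegralRep w), s.domain = {t | (∀ i, 0 < t i) ∧ (∀ i, t i < 1) ∧ StrictAnti t} ∧ Set.EqOn s.integrand (fun t => (q : ℝ) * ∏ i, if ε i then 1 / (1 - t i) else 1 / t i) s.domain ∧ x = Literature.NumberTheory.Transcendental.KZ.of s} : Set KZ.FormalRep)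
/-- Convergent cubical atoms of dimension `k`. -/
local notation "ATOMS⟪" k "⟫" =>
  ({z : Literature.NumberTheory.Transcendental.KZ.FormalRep | ∃ (q : ℚ) (a : Fin k → ℕ) (e : Fin k → Fin k → ℤ) (s : Literature.NumberTheory.Transcendental.KZ.IntegralRep k), s.domain = {x : Fin k → ℝ | ∀ i, x i ∈ Set.Ioo (0:ℝ) 1} ∧ Set.EqOn s.integrand (fun x => (q : ℝ) * ((∏ i : Fin k, x i ^ a i) * ∏ i : Fin k, ∏ j : Fin k, if i ≤ j then (1 - (∏ l : Fin k, if i ≤ l ∧ l ≤ j then x l else 1)) ^ e i j else 1)) s.domain ∧ z = Literature.NumberTheory.Transcendental.KZ.of s} : Set KZ.FormalRep)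
/-- Atoms of dimension `< k`. -/
local notation "ATOMSLT⟪" k "⟫" =>
  ({z : Literature.NumberTheory.Transcendental.KZ.FormalRep | ∃ d : ℕ, d < k ∧ z ∈ {z : Literature.NumberTheory.Transcendental.KZ.FormalRep | ∃ (q : ℚ) (a : Fin d → ℕ) (e : Fin d → Fin d → ℤ) (s : Literature.NumberTheory.Transcendental.KZ.IntegralRep d), s.domain = {x : Fin d → ℝ | ∀ i, x i ∈ Set.Ioo (0:ℝ) 1} ∧ Set.EqOn s.integrand (fun x => (q : ℝ) * ((∏ i : Fin d, x i ^ a i) * ∏ i : Fin d, ∏ j : Fin d, if i ≤ j then (1 - (∏ l : Fin d, if i ≤ l ∧ l ≤ j then x l else 1)) ^ e i j else 1)) s.domain ∧ z = Literature.NumberTheory.Transcendental.KZ.of s}} : Set KZ.FormalRep)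
/-- Atoms with an `SD1` descent direction. -/
local notation "SDATOMS⟪" k "⟫" =>
  ({z : Literature.NumberTheory.Transcendental.KZ.FormalRep | ∃ (q : ℚ) (a : Fin k → ℕ) (e : Fin k → Fin k → ℤ) (s : Literature.NumberTheory.Transcendental.KZ.IntegralRep k), (∃ lam : Fin k → ℤ, (∀ l : Fin k, lam l = 0 ∨ lam l = 1 ∨ lam l = -1) ∧ (∃ p : Fin k, lam p = -1) ∧ (Finset.univ.filter (fun l : Fin k => lam l = 1)).card ≤ 1 ∧ (∀ i j : Fin k, i ≤ j → e i j ≠ 0 → (∑ l : Fin k, if i ≤ l ∧ l ≤ j then lam l else 0) = 0) ∧ (∑ l : Fin k, lam l * ((a l : ℤ) + 1)) ≠ 0) ∧ s.domain = {x : Fin k → ℝ | ∀ i, x i ∈ Set.Ioo (0:ℝ) 1} ∧ Set.EqOn s.integrand (fun x => (q : ℝ) * ((∏ i : Fin k, x i ^ a i) * ∏ i : Fin k, ∏ j : Fin k, if i ≤ j then (1 - (∏ l : Fin k, if i ≤ l ∧ l ≤ j then x l else 1)) ^ e i j else 1)) s.domain ∧ z = Literature.NumberTheory.Transcendental.KZ.of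 s} : Set KZ.FormalRep)
/-- Nested atoms. -/
local notation "NATOMS⟪" k "⟫" =>
  ({z : Literature.NumberTheory.Transcendental.KZ.FormalRep | ∃ (q : ℚ) (a : Fin k → ℕ) (e : Fin k → Fin k → ℤ) (s : Literature.NumberTheory.Transcendental.KZ.IntegralRep k), (∀ i j i' j' : Fin k, i < j → i' < j' → e i j ≠ 0 → e i' j' ≠ 0 → (i ≤ i' ∧ j' ≤ j) ∨ (i' ≤ i ∧ j ≤ j')) ∧ s.domain = {x : Fin k → ℝ | ∀ i, x i ∈ Set.Ioo (0:ℝ) 1} ∧ Set.EqOn s.integrand (fun x => (q : ℝ) * ((∏ i : Fin k, x i ^ a i) * ∏ i : Fin k, ∏ j : Fin k, if i ≤ j then (1 - (∏ l : Fin k, if i ≤ l ∧ l ≤ j then x l else 1)) ^ e i j else 1)) s.domain ∧ z = Literature.NumberTheory.Transcendental.KZ.of s} : Set KZ.FormalRep)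
/-- Word atoms. -/
local notation "WATOMS⟪" k "⟫" =>
  ({z : Literature.NumberTheory.Transcendental.KZ.FormalRep | ∃ (q : ℚ) (ε : Fin k → Bool) (s : Literature.NumberTheory.Transcendental.KZ.IntegralRep k), s.domain = {x : Fin k → ℝ | ∀ i, x i ∈ Set.Ioo (0:ℝ) 1} ∧ Set.EqOn s.integrand (fun x => (q : ℝ) * ((∏ i : Fin k, x i ^ (k - 1 - (i : ℕ))) * ∏ i : Fin k, if ε i then 1 / (1 - (∏ l : Fin k, if l ≤ i then x l else 1)) else 1 / (∏ l : Fin k, if l ≤ i then x l else 1))) s.domain ∧ z = Literature.NumberTheory.Transcendental.KZ.of s} : Set KZ.FormalRep)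
/-- Generator-wise reduction modulo `KZ.relations` of the family `S` onto the family `T`. -/
local notation "RED⟪" S ", " T "⟫" =>
  (∀ x ∈ (S : Set KZ.FormalRep), ∃ c ∈ AddSubgroup.closure (T : Set KZ.FormalRep), x - c ∈ KZ.relations)
/-- The residual statement `stub_unnestingHigh` of the line: unnesting in dimension `≥ 4`. -/
local notation "UNNESTING_HIGH" =>
  (∀ (k : ℕ) (q : ℚ) (a : Fin k → ℕ) (e : Fin k → Fin k → ℤ) (s : Literature.NumberTheory.Transcendental.KZ.IntegralRep k), 4 ≤ k → s.domain = {x : Fin k → ℝ | ∀ i, x i ∈ Set.Ioo (0:ℝ) 1} → Set.EqOn s.integrand (fun x => (q : ℝ) * ((∏ i : Fin k, x i ^ a i) * ∏ i : Fin k, ∏ j : Fin k, if i ≤ j then (1 - (∏ l : Fin k, if i ≤ l ∧ l ≤ j then x l else 1)) ^ e i j else 1)) s.domain → ¬ (∀ i j i' j' : Fin k, i < j → i' < j' → e i j ≠ 0 → e i' j' ≠ 0 → (i ≤ i' ∧ j' ≤ j) ∨ (i' ≤ i ∧ j ≤ j')) → ∃ m ∈ AddSubgroup.closure ({z : Literature.NumberTheory.Transcendental.KZ.FormalRep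 | ∃ (q : ℚ) (a : Fin k → ℕ) (e : Fin k → Fin k → ℤ) (s : Literature.NumberTheory.Transcendental.KZ.IntegralRep k), (∀ i j i' j' : Fin k, i < j → i' < j' → e i j ≠ 0 → e i' j' ≠ 0 → (i ≤ i' ∧ j' ≤ j) ∨ (i' ≤ i ∧ j ≤ j')) ∧ s.domain = {x : Fin k → ℝ | ∀ i, x i ∈ Set.Ioo (0:ℝ) 1} ∧ Set.EqOn s.integrand (fun x => (q : ℝ) * ((∏ i : Fin k, x i ^ a i) * ∏ i : Fin k, ∏ j : Fin k, if i ≤ j then (1 - (∏ l : Fin k, if i ≤ l ∧ l ≤ j then x l else 1)) ^ e i j else 1)) s.domain ∧ z = Literature.NumberTheory.Transcendental.KZ.of s} ∪ {z : Literature.NumberTheory.Transcendental.KZ.FormalRep | ∃ (q : ℚ) (a : Fin k → ℕ) (e : Fin k → Fin k → ℤ) (s : Literature.NumberTheory.Transcendental.KZ.IntegralRep k), (∃ lam : Fin k → ℤ, (∀ l : Fin k, lam l = 0 ∨ lam l = 1 ∨ lam l = -1) ∧ (∃ p : Fin k, lam p = -1) ∧ (Finset.univ.filter (fun l : Fin k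 => lam l = 1)).card ≤ 1 ∧ (∀ i j : Fin k, i ≤ j → e i j ≠ 0 → (∑ l : Fin k, if i ≤ l ∧ l ≤ j then lam l else 0) = 0) ∧ (∑ l : Fin k, lam l * ((a l : ℤ) + 1)) ≠ 0) ∧ s.domain = {x : Fin k → ℝ | ∀ i, x i ∈ Set.Ioo (0:ℝ) 1} ∧ Set.EqOn s.integrand (fun x => (q : ℝ) * ((∏ i : Fin k, x i ^ a i) * ∏ i : Fin k, ∏ j : Fin k, if i ≤ j then (1 - (∏ l : Fin k, if i ≤ l ∧ l ≤ j then x l else 1)) ^ e i j else 1)) s.domain ∧ z = Literature.NumberTheory.Transcendental.KZ.of s} ∪ {z : Literature.NumberTheory.Transcendental.KZ.FormalRep | ∃ (q : ℚ) (ε : Fin k → Bool) (s : Literature.NumberTheory.Transcendental.KZ.IntegralRep k), s.domain = {x : Fin k → ℝ | ∀ i, x i ∈ Set.Ioo (0:ℝ) 1} ∧ Set.EqOn s.integrand (fun x => (q : ℝ) * ((∏ i : Fin k, x i ^ (k - 1 - (i : ℕ))) * ∏ i : Fin k, if ε i then 1 / (1 - (∏ l : Fin k, if l ≤ i then x l else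 1)) else 1 / (∏ l : Fin k, if l ≤ i then x l else 1))) s.domain ∧ z = Literature.NumberTheory.Transcendental.KZ.of s} ∪ {z : Literature.NumberTheory.Transcendental.KZ.FormalRep | ∃ d : ℕ, d < k ∧ z ∈ {z : Literature.NumberTheory.Transcendental.KZ.FormalRep | ∃ (q : ℚ) (a : Fin d → ℕ) (e : Fin d → Fin d → ℤ) (s : Literature.NumberTheory.Transcendental.KZ.IntegralRep d), s.domain = {x : Fin d → ℝ | ∀ i, x i ∈ Set.Ioo (0:ℝ) 1} ∧ Set.EqOn s.integrand (fun x => (q : ℝ) * ((∏ i : Fin d, x i ^ a i) * ∏ i : Fin d, ∏ j : Fin d, if i ≤ j then (1 - (∏ l : Fin d, if i ≤ l ∧ l ≤ j then x l else 1)) ^ e i j else 1)) s.domain ∧ z = Literature.NumberTheory.Transcendental.KZ.of s}}), Literature.NumberTheory.Transcendental.KZ.of s - m ∈ Literature.NumberTheory.Transcendental.KZ.relations : Prop)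

set_option quotPrecheck true

/-! ### The induction over all dimensions -/

/-- Every atom reduces to words, given unnesting in dimension `≥ 4`: strong induction on the
dimension; non-nested atoms are unnested first (`stub_unnesting_le_three` in dimension `≤ 3`, the
hypothesis in dimension `≥ 4`), nested ones go through `DimLeThree.nAtom_red` (Theorem N), the
other generators through `DimLeThree.sd1Atom_red`, `DimLeThree.wAtom_red`, `DimLeThree.atomLT_red`. -/
theorem atom_red (hU : UNNESTING_HIGH) : ∀ k : ℕ, RED⟪ATOMS⟪k⟫, WORDS⟫ := by
  intro k
  induction k using Nat.strong_induction_on with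
  | _ k IH =>
    rintro z ⟨q, a, e, s, hdom, hint, rfl⟩
    by_cases hN : (∀ i j i' j' : Fin k, i < j → i' < j' → e i j ≠ 0 → e i' j' ≠ 0 →
        (i ≤ i' ∧ j' ≤ j) ∨ (i' ≤ i ∧ j ≤ j'))
    · exact nAtom_red k IH _ ⟨q, a, e, s, hN, hdom, hint, rfl⟩
    · have h4 : RED⟪NATOMS⟪k⟫ ∪ SDATOMS⟪k⟫ ∪ WATOMS⟪k⟫ ∪ ATOMSLT⟪k⟫, WORDS⟫ :=
        red_union (red_union (red_union (nAtom_red k IH) (sd1Atom_red k IH)) (wAtom_red k))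
          (atomLT_red k IH)
      by_cases hk : k ≤ 3
      · obtain ⟨m, hm, hsm⟩ := stub_unnesting_le_three k q a e s hk hdom hint hN
        exact red_of_sub_mem hsm (closure_transfer h4 m hm)
      · obtain ⟨m, hm, hsm⟩ := hU k q a e s (by omega) hdom hint hN
        exact red_of_sub_mem hsm (closure_transfer h4 m hm)

end OfUnnestingHigh

/-- **`DihedralNormalForm` from unnesting in dimension `≥ 4`** (the conditional closing theorem
of the line `torus-descent-sum-shadow`). If every non-nested convergent cubical atom of dimension
`k ≥ 4` is congruent modulo `KZ.relations` to a `ℤ`-combination of nested, SD1-directed, word and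
lower-dimensional atoms (the residual statement `stub_unnestingHigh`, verbatim), then
`LinRedNormalForm.DihedralNormalForm` holds: every absolutely convergent genus-zero representation on
an open ordered simplex is congruent modulo `KZ.relations` to a `ℤ`-combination of MZV word
representations. Proof: reduce the input to convergent cubical atoms (`stub_atomReduction`), every
atom to words (`OfUnnestingHigh.atom_red`: unnesting, Theorem N, torus descent, re-cubing, the
word-atom chart), and extend additively (`DimLeThree.closure_transfer`).
[cite: KontsevichZagier2001, §1.2] -/
theorem dihedralNormalForm_of_unnestingHigh : (∀ (k : ℕ) (q : ℚ) (a : Fin k → ℕ) (e : Fin k → Fin k → ℤ) (s : Literature.NumberTheory.Transcendental.KZ.IntegralRep k), 4 ≤ k → s.domain = {x : Fin k → ℝ | ∀ i, x i ∈ Set.Ioo (0:ℝ) 1} → Set.EqOn s.integrand (fun x => (q : ℝ) * ((∏ i : Fin k, x i ^ a i) * ∏ i : Fin k, ∏ j : Fin k, if i ≤ j then (1 - (∏ l : Fin k, if i ≤ l ∧ l ≤ j then x l else 1)) ^ e i j else 1)) s.domain → ¬ (∀ i j i' j' : Fin k, i < j → i' < j' → e i j ≠ 0 → e i' j' ≠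 0 → (i ≤ i' ∧ j' ≤ j) ∨ (i' ≤ i ∧ j ≤ j')) → ∃ m ∈ AddSubgroup.closure ({z : Literature.NumberTheory.Transcendental.KZ.FormalRep | ∃ (q : ℚ) (a : Fin k → ℕ) (e : Fin k → Fin k → ℤ) (s : Literature.NumberTheory.Transcendental.KZ.IntegralRep k), (∀ i j i' j' : Fin k, i < j → i' < j' → e i j ≠ 0 → e i' j' ≠ 0 → (i ≤ i' ∧ j' ≤ j) ∨ (i' ≤ i ∧ j ≤ j')) ∧ s.domain = {x : Fin k → ℝ | ∀ i, x i ∈ Set.Ioo (0:ℝ) 1} ∧ Set.EqOn s.integrand (fun x => (q : ℝ) * ((∏ i : Fin k, x i ^ a i) * ∏ i : Fin k, ∏ j : Fin k, if i ≤ j then (1 - (∏ l : Fin k, if i ≤ l ∧ l ≤ j then x l else 1)) ^ e i j else 1)) s.domain ∧ z = Literature.NumberTheory.Transcendental.KZ.of s} ∪ {z : Literature.NumberTheory.Transcendental.KZ.FormalRep | ∃ (q : ℚ) (a : Fin k → ℕ) (e : Fin k → Fin k → ℤ) (s : Literature.NumberTheory.Transcendental.KZ.IntegralRep k), (∃ lam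 : Fin k → ℤ, (∀ l : Fin k, lam l = 0 ∨ lam l = 1 ∨ lam l = -1) ∧ (∃ p : Fin k, lam p = -1) ∧ (Finset.univ.filter (fun l : Fin k => lam l = 1)).card ≤ 1 ∧ (∀ i j : Fin k, i ≤ j → e i j ≠ 0 → (∑ l : Fin k, if i ≤ l ∧ l ≤ j then lam l else 0) = 0) ∧ (∑ l : Fin k, lam l * ((a l : ℤ) + 1)) ≠ 0) ∧ s.domain = {x : Fin k → ℝ | ∀ i, x i ∈ Set.Ioo (0:ℝ) 1} ∧ Set.EqOn s.integrand (fun x => (q : ℝ) * ((∏ i : Fin k, x i ^ a i) * ∏ i : Fin k, ∏ j : Fin k, if i ≤ j then (1 - (∏ l : Fin k, if i ≤ l ∧ l ≤ j then x l else 1)) ^ e i j else 1)) s.domain ∧ z = Literature.NumberTheory.Transcendental.KZ.of s} ∪ {z : Literature.NumberTheory.Transcendental.KZ.FormalRep | ∃ (q : ℚ) (ε : Fin k → Bool) (s : Literature.NumberTheory.Transcendental.KZ.IntegralRep k), s.domain = {x : Fin k → ℝ | ∀ i, x i ∈ Set.Ioo (0:ℝ) 1} ∧ Set.EqOn s.integrand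 (fun x => (q : ℝ) * ((∏ i : Fin k, x i ^ (k - 1 - (i : ℕ))) * ∏ i : Fin k, if ε i then 1 / (1 - (∏ l : Fin k, if l ≤ i then x l else 1)) else 1 / (∏ l : Fin k, if l ≤ i then x l else 1))) s.domain ∧ z = Literature.NumberTheory.Transcendental.KZ.of s} ∪ {z : Literature.NumberTheory.Transcendental.KZ.FormalRep | ∃ d : ℕ, d < k ∧ z ∈ {z : Literature.NumberTheory.Transcendental.KZ.FormalRep | ∃ (q : ℚ) (a : Fin d → ℕ) (e : Fin d → Fin d → ℤ) (s : Literature.NumberTheory.Transcendental.KZ.IntegralRep d), s.domain = {x : Fin d → ℝ | ∀ i, x i ∈ Set.Ioo (0:ℝ) 1} ∧ Set.EqOn s.integrand (fun x => (q : ℝ) * ((∏ i : Fin d, x i ^ a i) * ∏ i : Fin d, ∏ j : Fin d, if i ≤ j then (1 - (∏ l : Fin d, if i ≤ l ∧ l ≤ j then x l else 1)) ^ e i j else 1)) s.domain ∧ z = Literature.NumberTheory.Transcendental.KZ.of s}}), Literature.NumberTheory.Transcendental.KZ.of s - m ∈ Literature.NumberTheory.Transcendental.KZ.relations) → Summit.KontsevichZagierPeriods.KontsevichZagierPeriods.Theses.LinRedNormalForm.DihedralNormalForm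 := by
  intro hU k r p a b c hdom hint
  obtain ⟨m, hm, hrm⟩ := stub_atomReduction k r p a b c hdom hint
  exact DimLeThree.red_of_sub_mem hrm
    (DimLeThree.closure_transfer (OfUnnestingHigh.atom_red hU k) m hm)

end Summit.KontsevichZagierPeriods.DihedralNormalForm.TorusDescent
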